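import Mathlib
import HarnessLib
import Summits.ResolutionOfSingularities.ResolutionOfSingularities.Theorems.WildQuotientsWildQuotientResolutionS1aRootNodeAway

/-!
# S1a — K-LOC (α1): the ADMISSIBLE POINT-TYPE CENTRE `(x_{v 0}, …)` with weights `w` ON AN INVARIANT BASIC OPEN `D(b)` of a polynomial chart

[OURS · L1 W4.5c · lead-1 g16; plan-1 RULING R-F15o (3) design (α1) — one member `𝒦ᵢ` of a multi-support root: the centre of VARIABLES `x_{v l}` (weights `w`) of the polynomial
chart `e : Γ(M,O) ≃ k[x]`, realised on the σ-stable basic open `D(e⁻¹hh)` (`σ hh = hh`, `hh ≠ 0` at the centre) through ✓`exists_rootNodeAway` (node of `D(b)` with model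
`k[x][1/hh]`) and ✓`exists_isAdmissibleCentre_of_modelNode` (p663025 lineage); `supp 𝒦 ⊆ D(b)` so that finitely many such centres with disjoint supports glue by
✓`MultiRoot.isAdmissibleCentre_infRees_of_disjoint` and move by ✓`exists_moveAtlas_of_nodes`] — NOT statements of the manuscript; counted 0; AI-level work, weaker than
expert review. Crux stmt-ResolutionOfSingularities-17941 `CyclicQuotientFourfolds`, line `s1a-logminvertex` v13 (`stub_reachLowerInFX`).

* ★★ `exists_pointCentre_away` — INPUT: the polynomial chart `(O, e, σ)` of a model, a σ-fixed `hh`, centre variables `v` (injective) with positive weights `w` and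
  σ-adaptedness of `𝒥(x_v; w)` on `k[x]`, a `k`-point `g` of `V(x_v)` with `hh(g) ≠ 0`, and `V_O(e⁻¹x_v) ∩ O` closed in `M` and contained in `D(e⁻¹hh)`. OUTPUT: the node
  `DW` of `D(e⁻¹hh)` with its model `Φ : DW.B ≃ k[x][1/hh]` (pins of ✓`exists_rootNodeAway`) AND an ADMISSIBLE centre `𝒦` of some Veronese degree `d > 0` with
  `D(e⁻¹hh)` a centre chart, `G`-stability, the filtration clause `(𝒦|D)_n = eL⁻¹(trace 𝒥ₙ(x_v/1; w))`, `VeroneseNormalised` and `supp 𝒦_d ⊆ D(e⁻¹hh)`.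
-/

set_option linter.dupNamespace false

noncomputable section

open CategoryTheory Limits AlgebraicGeometry TopologicalSpace Topology Opposite MvPolynomial
open Literature.AlgebraicGeometry.Resolution Literature.AlgebraicGeometry.RelativeSpec
open Summit.ResolutionOfSingularities.ResolutionOfSingularities.Theorems.WildQuotientResolution.S1
open Summit.ResolutionOfSingularities.ResolutionOfSingularities.Theorems.WildQuotientResolution.S1.NodeAtlas
open Summit.ResolutionOfSingularities.ResolutionOfSingularities.Theorems.WildQuotientResolution.S1.CoarseChart
open Summit.ResolutionOfSingularities.ResolutionOfSingularities.Theorems.WildQuotientResolution.S1.ProducerStep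
open Summit.ResolutionOfSingularities.ResolutionOfSingularities.Theorems.WildQuotientResolution.S1.NpFrame
open Summit.ResolutionOfSingularities.ResolutionOfSingularities.Theorems.WildQuotientResolution.S1.GoodCharts
open Summit.ResolutionOfSingularities.ResolutionOfSingularities.Theorems.WildQuotientResolution.S1.NodeAway
open Summit.ResolutionOfSingularities.ResolutionOfSingularities.Theorems.WildQuotientResolution.S1.NodeChartAway
open Summit.ResolutionOfSingularities.ResolutionOfSingularities.Theorems.WildQuotientResolution.S1.NodeTransport
open Summit.ResolutionOfSingularities.ResolutionOfSingularities.Theorems.WildQuotientResolution.S1.CentreAway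
open Summit.ResolutionOfSingularities.ResolutionOfSingularities.Theorems.WildQuotientResolution.S1.BlowupCharts

namespace Summit.ResolutionOfSingularities.ResolutionOfSingularities.Theorems.WildQuotientResolution.S1.GameFrame.GModel

variable {p : ℕ} {X' X₁ : Scheme.{0}} {q : X' ⟶ X₁} {G : Type} [Group G] {ρ : G →* Aut X'} {g₀ : G}

set_option maxHeartbeats 8000000 in
/-- ★★ **THE ADMISSIBLE POINT-TYPE CENTRE ON AN INVARIANT BASIC OPEN OF A POLYNOMIAL CHART** (one member of a multi-support root). See the module docstring.
[OURS · L1 W4.5c · K-LOC (α1); NOT a statement of the manuscript] -/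
theorem exists_pointCentre_away [Finite G] (hG : ∀ g : G, g ∈ Subgroup.zpowers g₀) (M : GModel p q G ρ g₀) [M.V.IsSeparated]
    (O : M.act.StableAffineOpens) (hO : IsAffineOpen O.1)
    {k : Type} [Field k] {ι : Type} [Fintype ι] [DecidableEq ι] (e : Γ(M.V, O.1) ≃+* MvPolynomial ι k) (σ : MvPolynomial ι k ≃+* MvPolynomial ι k)
    (hact : ∀ t : Γ(M.V, O.1), actOEquiv M.act O g₀ t = e.symm (σ (e t))) (hσp : ∀ a : MvPolynomial ι k, (⇑σ)^[p] a = a)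
    (hh : MvPolynomial ι k) (hσh : σ hh = hh)
    {c : ℕ} (hc : 0 < c) (v : Fin c → ι) (hv : Function.Injective v) (w : Fin c → ℕ) (hw : ∀ i, 0 < w i)
    (hσJ : ∀ n : ℕ, ((weightedFiltration ((X : ι → MvPolynomial ι k) ∘ v) w).ideal n).map (σ : MvPolynomial ι k →+* MvPolynomial ι k) ≤
      (weightedFiltration ((X : ι → MvPolynomial ι k) ∘ v) w).ideal n)
    (g : ι → k) (hg : ∀ i, g (v i) = 0) (hu : MvPolynomial.eval g hh ≠ 0)
    (hZcl : IsClosed (M.V.zeroLocus (U := O.1) (Set.range (e.symm ∘ (X : ι → MvPolynomial ι k) ∘ v)) ∩ (O.1 : Set M.V)))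
    (hZW : M.V.zeroLocus (U := O.1) (Set.range (e.symm ∘ (X : ι → MvPolynomial ι k) ∘ v)) ∩ (O.1 : Set M.V) ⊆ (M.V.basicOpen (e.symm hh) : Set M.V)) :
    ∃ (DW : NodeData p M.act g₀ (basicOpenStable M.act O hO (actO_symm_eq_of_fixed hG M O e σ hact hh hσh)))
      (Φ : letI := DW.instCommRing; DW.B ≃+* Localization.Away hh),
      (letI := DW.instCommRing; ∀ t : Γ(M.V, O.1),
        Φ ((DW.e (algebraMap Γ(M.V, O.1) Γ(M.V, M.V.basicOpen (e.symm hh)) t) : ↥(DW.𝒜 0)) : DW.B) =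
          algebraMap (MvPolynomial ι k) (Localization.Away hh) (e t)) ∧
      (letI := DW.instCommRing; ∀ x : Localization.Away hh, Φ (DW.σ (Φ.symm x)) = sigmaAway σ hσh x) ∧
      (letI := DW.instCommRing; letI := DW.instGradedRing; ∀ (i : Π j : Fin DW.m, ZMod (DW.r j)) (x : Localization.Away hh), x ∈ mapGrading DW.𝒜 Φ i) ∧
      letI := DW.instCommRing; letI := DW.instGradedRing; letI := mapGradedRing DW.𝒜 Φ
      ∃ (𝒦 : ReesFiltration M.V) (d : ℕ), 0 < d ∧ IsAdmissibleCentre p M.act g₀ 𝒦 d ∧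
        IsCentreChart p M.act g₀ 𝒦 d (basicOpenStable M.act O hO (actO_symm_eq_of_fixed hG M O e σ hact hh hσh)) ∧
        (∀ (g : G) (n : ℕ), (𝒦.ideal n).comap (M.act.aut g).hom = 𝒦.ideal n) ∧
        (∀ n, (𝒦.filtration ⟨(basicOpenStable M.act O hO (actO_symm_eq_of_fixed hG M O e σ hact hh hσh)).1, DW.affine⟩).ideal n =
          ((traceFiltration (mapGrading DW.𝒜 Φ) (fun i => algebraMap (MvPolynomial ι k) (Localization.Away hh) (X (v i))) w).ideal n).comap
            ((DW.e.trans (zeroRingEquiv DW.𝒜 Φ) : Γ(M.V, (basicOpenStable M.act O hO (actO_symm_eq_of_fixed hG M O e σ hact hh hσh)).1) ≃+* ↥(mapGrading DW.𝒜 Φ 0)) :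
              Γ(M.V, (basicOpenStable M.act O hO (actO_symm_eq_of_fixed hG M O e σ hact hh hσh)).1) →+* ↥(mapGrading DW.𝒜 Φ 0))) ∧
        VeroneseNormalised (mapGrading DW.𝒜 Φ) (fun i => algebraMap (MvPolynomial ι k) (Localization.Away hh) (X (v i))) w d ∧
        (((𝒦.ideal d).support : Set M.V)) ⊆ ((basicOpenStable M.act O hO (actO_symm_eq_of_fixed hG M O e σ hact hh hσh)).1 : Set M.V) := by
  classical
  obtain ⟨DW, Φ, hpin, hconj, htop⟩ := exists_rootNodeAway hG M O hO e σ hact hσp hh hσh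
  letI := DW.instCommRing
  letI := DW.instGradedRing
  letI := mapGradedRing DW.𝒜 Φ
  have hb : ∀ g : G, actO M.act O g (e.symm hh) = e.symm hh := actO_symm_eq_of_fixed hG M O e σ hact hh hσh
  -- σ-adaptedness of the localised centre for `conj Φ DW.σ = sigmaAway σ`
  have hconj' : (conj Φ DW.σ : Localization.Away hh →+* Localization.Away hh) = (sigmaAway σ hσh : Localization.Away hh →+* Localization.Away hh) :=
    RingHom.ext fun x => hconj x
  have hσJ' : ∀ n : ℕ, ((weightedFiltration (fun i => algebraMap (MvPolynomial ι k) (Localization.Away hh) (X (v i))) w).ideal n).map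
      (conj Φ DW.σ : Localization.Away hh →+* Localization.Away hh) ≤
        (weightedFiltration (fun i => algebraMap (MvPolynomial ι k) (Localization.Away hh) (X (v i))) w).ideal n := fun n => by
    rw [hconj']
    exact map_sigmaAway_weightedFiltration_le ((X : ι → MvPolynomial ι k) ∘ v) w σ hσh hσJ n
  -- the closure condition: `V_W(J_n) ∩ W ⊆ V_O(e⁻¹x_v) ∩ O`, which is closed in `M` and inside `W = D(b)`
  have hcl : ∀ n : ℕ, 0 < n → closure (M.V.zeroLocus (U := (basicOpenStable M.act O hO hb).1)
      ((((traceFiltration (mapGrading DW.𝒜 Φ) (fun i => algebraMap (MvPolynomial ι k) (Localization.Away hh) (X (v i))) w).ideal n).comap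
          ((DW.e.trans (zeroRingEquiv DW.𝒜 Φ) : Γ(M.V, (basicOpenStable M.act O hO hb).1) ≃+* ↥(mapGrading DW.𝒜 Φ 0)) :
            Γ(M.V, (basicOpenStable M.act O hO hb).1) →+* ↥(mapGrading DW.𝒜 Φ 0)) : Ideal Γ(M.V, (basicOpenStable M.act O hO hb).1)) : Set Γ(M.V, (basicOpenStable M.act O hO hb).1)) ∩
        ((basicOpenStable M.act O hO hb).1 : Set M.V)) ⊆ ((basicOpenStable M.act O hO hb).1 : Set M.V) := by
    intro n hn
    have hsub : M.V.zeroLocus (U := (basicOpenStable M.act O hO hb).1)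
        ((((traceFiltration (mapGrading DW.𝒜 Φ) (fun i => algebraMap (MvPolynomial ι k) (Localization.Away hh) (X (v i))) w).ideal n).comap
            ((DW.e.trans (zeroRingEquiv DW.𝒜 Φ) : Γ(M.V, (basicOpenStable M.act O hO hb).1) ≃+* ↥(mapGrading DW.𝒜 Φ 0)) :
              Γ(M.V, (basicOpenStable M.act O hO hb).1) →+* ↥(mapGrading DW.𝒜 Φ 0)) : Ideal Γ(M.V, (basicOpenStable M.act O hO hb).1)) : Set Γ(M.V, (basicOpenStable M.act O hO hb).1)) ∩
          ((basicOpenStable M.act O hO hb).1 : Set M.V) ⊆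
        M.V.zeroLocus (U := O.1) (Set.range (e.symm ∘ (X : ι → MvPolynomial ι k) ∘ v)) ∩ (O.1 : Set M.V) := by
      rintro x ⟨hxZ, hxW⟩
      refine ⟨(Scheme.mem_zeroLocus_iff _ _ _).mpr ?_, M.V.basicOpen_le _ hxW⟩
      rintro _ ⟨i, rfl⟩
      -- the restricted section `t_i = (e⁻¹ x_{v i})|_W` has `t_i ^ n ∈ J_n`
      have hmem : (algebraMap Γ(M.V, O.1) Γ(M.V, M.V.basicOpen (e.symm hh)) (e.symm (X (v i)))) ^ n ∈
          (((traceFiltration (mapGrading DW.𝒜 Φ) (fun i => algebraMap (MvPolynomial ι k) (Localization.Away hh) (X (v i))) w).ideal n).comap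
            ((DW.e.trans (zeroRingEquiv DW.𝒜 Φ) : Γ(M.V, (basicOpenStable M.act O hO hb).1) ≃+* ↥(mapGrading DW.𝒜 Φ 0)) :
              Γ(M.V, (basicOpenStable M.act O hO hb).1) →+* ↥(mapGrading DW.𝒜 Φ 0)) : Ideal Γ(M.V, (basicOpenStable M.act O hO hb).1)) := by
        have hval : (((DW.e.trans (zeroRingEquiv DW.𝒜 Φ)) (algebraMap Γ(M.V, O.1) Γ(M.V, M.V.basicOpen (e.symm hh)) (e.symm (X (v i)))) : ↥(mapGrading DW.𝒜 Φ 0)) :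
            Localization.Away hh) = algebraMap (MvPolynomial ι k) (Localization.Away hh) (X (v i)) := by
          have h1 := hpin (e.symm (X (v i)))
          rw [e.apply_symm_apply] at h1
          exact h1
        -- `t ∈ eL⁻¹(trace 𝒥₁)`, then powers
        have h1 : algebraMap Γ(M.V, O.1) Γ(M.V, M.V.basicOpen (e.symm hh)) (e.symm (X (v i))) ∈
            (((traceFiltration (mapGrading DW.𝒜 Φ) (fun i => algebraMap (MvPolynomial ι k) (Localization.Away hh) (X (v i))) w).ideal 1).comap
              ((DW.e.trans (zeroRingEquiv DW.𝒜 Φ) : Γ(M.V, (basicOpenStable M.act O hO hb).1) ≃+* ↥(mapGrading DW.𝒜 Φ 0)) :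
                Γ(M.V, (basicOpenStable M.act O hO hb).1) →+* ↥(mapGrading DW.𝒜 Φ 0)) : Ideal Γ(M.V, (basicOpenStable M.act O hO hb).1)) := by
          refine Ideal.mem_comap.mpr ?_
          change (DW.e.trans (zeroRingEquiv DW.𝒜 Φ)) (algebraMap Γ(M.V, O.1) Γ(M.V, M.V.basicOpen (e.symm hh)) (e.symm (X (v i)))) ∈ _
          rw [mem_traceFiltration_iff, hval]
          exact (weightedFiltration _ _).antitone (hw i) (mem_weightedFiltration_ideal (fun i => algebraMap (MvPolynomial ι k) (Localization.Away hh) (X (v i))) w i)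
        have h2 := Ideal.pow_mem_pow h1 n
        refine (Ideal.le_comap_pow _ n).trans (Ideal.comap_mono ?_) h2
        have h3 := Veronese.idealFiltration_pow_le (traceFiltration (mapGrading DW.𝒜 Φ) (fun i => algebraMap (MvPolynomial ι k) (Localization.Away hh) (X (v i))) w) 1 n
        rwa [one_mul] at h3
      have hx := (Scheme.mem_zeroLocus_iff _ _ _).mp hxZ _ hmem
      have hpow := M.V.basicOpen_pow (algebraMap Γ(M.V, O.1) Γ(M.V, M.V.basicOpen (e.symm hh)) (e.symm (X (v i)))) hn
      have hres : M.V.basicOpen (algebraMap Γ(M.V, O.1) Γ(M.V, M.V.basicOpen (e.symm hh)) (e.symm (X (v i)))) =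
          M.V.basicOpen (e.symm hh) ⊓ M.V.basicOpen (e.symm (X (v i))) := by
        rw [RingHom.algebraMap_toAlgebra]
        exact Scheme.basicOpen_res _ _ _
      intro hxi
      refine hx ?_
      change x ∈ M.V.basicOpen ((algebraMap Γ(M.V, O.1) Γ(M.V, M.V.basicOpen (e.symm hh)) (e.symm (X (v i)))) ^ n)
      rw [hpow, hres]
      exact ⟨hxW, hxi⟩
    exact (closure_mono hsub).trans (hZcl.closure_subset.trans hZW)
  obtain ⟨𝒦, d, hd, hadm, hcentre, hG𝒦, hfil, hver, hsupp⟩ := exists_isAdmissibleCentre_of_modelNode hG M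
    (basicOpenStable M.act O hO hb) DW hh Φ hc v hv (fun _ => 0) w hw (fun i => htop _ _) g hg hu hσJ' hcl
  exact ⟨DW, Φ, hpin, hconj, htop, 𝒦, d, hd, hadm, hcentre, hG𝒦, hfil, hver, hsupp⟩

end Summit.ResolutionOfSingularities.ResolutionOfSingularities.Theorems.WildQuotientResolution.S1.GameFrame.GModel

end
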